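import Literature.Combinatorics.SimpleGraph.ColoringNoEdgeInversion        -- generic: `NoInversion.apply_eq_of_mapsTo_pair{,_of_lt}`, `sym2Map_mk_eq_iff_of_lt`, `image_pair_eq_iff_of_lt`
import Literature.NumberTheory.Automorphic.UnitaryLatticeTreeApartment    -- ★ `type_unique` (§16); brings ★ Types `eq_of_le_of_isVertexLattice` and ★ T1a Defs (`mapGL`, `latticeGraph`, `latticeGraphIso`)
import HarnessLib

/-!
# `U(σ, H)` — indeed all of `GL_N(K)` — acts on the lattice graph of a hermitian space WITHOUT INVERSION: an element stabilising an edge `{M, M′}` fixes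
# `M` and `M′`; edge set-stabiliser = `Stab(M) ⊓ Stab(M′)` (`P_F† = P_F`, `ε_F = 1`) (Bruhat–Tits 1972 §10; Serre, *Trees* I.3.1, II.1; Schneider–Stuhler 1997 III.4)

Topic `NumberTheory/Automorphic`; namespace `Literature.NumberTheory.Automorphic.UnitaryLatticeTree` (★ T1a's).  THEOREMS ONLY (no definition, no instance, no notation,
no named fact, no `sorry`).  Cell `pub/hodgecm-mathlib` (D-0151), crux H413 = `stmt-HodgeConjecture-24833`; census «E1 ∕ Kazhdan-in-house» §2-K1 (T) MISSING line «edges as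
facets with ORIENTATION `ε_F`: type-preserving action ⇒ `P_F† = P_F`, `ε = 1`» (E1 row 30).  HONEST LABEL: count-neutral generic base layer of the (R-SS) complex; HC_CM is proved
only modulo the 2 remaining named inputs (hLiu418 24832, h413 24833) until rung 0 closes; nothing printed is asserted here.

THE MATHEMATICS.  In the lattice model ★ `UnitaryLatticeTreeDefs` the vertices are LATTICES `M` (not homothety classes) and two vertices are adjacent iff one is STRICTLY
CONTAINED in the other (★ `latticeGraph_adj_iff`).  Every `g ∈ GL_N(K)` acts by `M ↦ g·M = mapGL g M`, which preserves strict inclusion (★ `mapGL_lt_mapGL_iff`); hence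
(O) `g` can never EXCHANGE the two ends `M < M′` of an edge: if `g·{M, M′} ⊆ {M, M′}` then `g·M = M` and `g·M′ = M′` (§1, generic ★ `NoInversion.apply_eq_of_mapsTo_pair_of_lt`).
For `u ∈ U(σ, H)` this is the statement that the graph automorphism ★ `latticeGraphIso σ ϖ H u` acts WITHOUT INVERSION (§2), and the printed reason is (C) TYPES: `u`
preserves the type `d` of a vertex (★ `isVertexLattice_mapGL_iff`), the type is unique (★ `type_unique`) and the two ends of an edge have DIFFERENT types (★
`eq_of_le_of_isVertexLattice`: comparable vertices of one type coincide) — §3 records this route too (`type_ne_of_lt`, `mapGL_ne_of_type_ne`,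
`mapGL_eq_of_mapsTo_pair_of_type_ne`, and the `U(σ, H)`-invariant proper colouring BY TYPE `exists_coloring_type`).  §4 says it in the subgroup currency of the
Schneider–Stuhler complex (hypothesis style, as ★ `UnitaryLatticeTreeLevelGroups`): the set-stabiliser `P_F†` of an edge `F = {M, M′}` IS `Stab(M) ⊓ Stab(M′) = P_F`, so the
orientation character `ε_F` of [SchneiderStuhler1997, III.4] is trivial and `C_c^{or}(X_(1); V) = ⊕_F cInd_{P_F}^G V^{U_F}` needs no sign.

* §1 (O) for any `g ∈ GL_N(K)`: **`mapGL_eq_of_mapsTo_pair_of_lt`**, `mapGL_image_pair_eq_iff_of_lt`, `mapGL_image_pair_eq_iff_of_lt_or_gt`, `mapGL_image_pair_eq_iff_of_adj`.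
* §2 `u ∈ U(σ, H)` on `latticeGraph σ ϖ H`: **`sym2Map_latticeGraphIso_eq_iff`**, `latticeGraphIso_apply_eq_of_sym2Map_eq` (every stabilised edge is fixed pointwise),
  `latticeGraphIso_apply_eq_of_mapEdgeSet_eq`.
* §3 (C) types: `type_ne_of_lt`, `mapGL_ne_of_type_ne`, **`mapGL_eq_of_mapsTo_pair_of_type_ne`** («type-preserving ⟹ no inversion»), `exists_coloring_type`.
* §4 subgroups: `exists_subgroup_mem_iff_mapGL_eq` (`Stab(M)`), `exists_subgroup_mem_iff_mapGL_image_pair_eq` (`P_F†`), **`eq_inf_of_mem_iff_mapGL_image_pair_eq`** (`P_F† = P_F`),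
  `eq_inf_of_mem_iff_mapGL_image_pair_eq_of_adj`.

## References
* [BruhatTits1972] F. Bruhat, J. Tits, *Groupes réductifs sur un corps local I*, Publ. Math. IHÉS 41 (1972), §10 (lattice models of the buildings of classical groups; stabilisers).
* [Serre1980Trees] J.-P. Serre, *Trees* (1980), Ch. I §3.1 (inversions), Ch. II §1.1–1.3 (`SL₂` acts on its tree without inversion, `GL₂` does not).
* [SchneiderStuhler1997] P. Schneider, U. Stuhler, *Representation theory and sheaves on the Bruhat–Tits building*, Publ. Math. IHÉS 85 (1997), III.4 (`P_F† ⊇ P_F`, `ε_F`).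
* [Meier2008] J. Meier, *Groups, Graphs and Trees* (2008), Corollary 3.47.
-/

set_option autoImplicit false

noncomputable section

open scoped Valued WithZero Matrix MatrixGroups
open Set

namespace Literature.NumberTheory.Automorphic.UnitaryLatticeTree

open Literature.NumberTheory.Automorphic Literature.NumberTheory.Automorphic.HermitianLattice
open Literature.Combinatorics.SimpleGraph

variable {K : Type*} [Field K] [Valued K ℤᵐ⁰] {N : ℕ}

/-! ## §1 (O): no element of `GL_N(K)` exchanges the ends of an edge -/

section Order

/-- **NO INVERSION (order route).**  If `M < M′` and `g ∈ GL_N(K)` maps `{M, M′}` into itself, then `g·M = M` and `g·M′ = M′` — `g` preserves strict inclusion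
(★ `mapGL_lt_mapGL_iff`), so it cannot exchange the ends. [cite: Serre1980Trees, II.1.1] [cite: BruhatTits1972, §10] -/
theorem mapGL_eq_of_mapsTo_pair_of_lt (g : GL (Fin N) K) {M M' : Submodule 𝒪[K] (Fin N → K)} (hlt : M < M') (h : MapsTo (mapGL g) {M, M'} {M, M'}) :
    mapGL g M = M ∧ mapGL g M' = M' :=
  NoInversion.apply_eq_of_mapsTo_pair_of_lt (mapGL g) ((mapGL_lt_mapGL_iff g M M').2 hlt) hlt h

/-- Image form: for `M < M′`, `g·{M, M′} = {M, M′} ↔ g·M = M ∧ g·M′ = M′`. [cite: Serre1980Trees, II.1.1] -/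
theorem mapGL_image_pair_eq_iff_of_lt (g : GL (Fin N) K) {M M' : Submodule 𝒪[K] (Fin N → K)} (hlt : M < M') :
    mapGL g '' {M, M'} = {M, M'} ↔ mapGL g M = M ∧ mapGL g M' = M' :=
  NoInversion.image_pair_eq_iff_of_lt (mapGL g) ((mapGL_lt_mapGL_iff g M M').2 hlt) hlt

/-- Symmetric form: for two strictly comparable lattices (either way round), `g·{M, M′} = {M, M′} ↔ g·M = M ∧ g·M′ = M′`. [cite: Serre1980Trees, II.1.1] -/
theorem mapGL_image_pair_eq_iff_of_lt_or_gt (g : GL (Fin N) K) {M M' : Submodule 𝒪[K] (Fin N → K)} (h : M < M' ∨ M' < M) :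
    mapGL g '' {M, M'} = {M, M'} ↔ mapGL g M = M ∧ mapGL g M' = M' := by
  rcases h with h | h
  · exact mapGL_image_pair_eq_iff_of_lt g h
  · rw [pair_comm, mapGL_image_pair_eq_iff_of_lt g h, and_comm]

/-- **For an EDGE `{v, w}` of the lattice graph, `g·{v, w} = {v, w} ↔ g·v = v ∧ g·w = w`** (any `g ∈ GL_N(K)`). [cite: BruhatTits1972, §10] [cite: Serre1980Trees, I.3.1] -/
theorem mapGL_image_pair_eq_iff_of_adj (σ : K →+* K) (ϖ : K) (H : Matrix (Fin N) (Fin N) K) {v w : {M : Submodule 𝒪[K] (Fin N → K) // IsVertex σ ϖ H M}}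
    (hadj : (latticeGraph σ ϖ H).Adj v w) (g : GL (Fin N) K) : mapGL g '' {v.1, w.1} = {v.1, w.1} ↔ mapGL g v.1 = v.1 ∧ mapGL g w.1 = w.1 :=
  mapGL_image_pair_eq_iff_of_lt_or_gt g ((latticeGraph_adj_iff σ ϖ H v w).1 hadj)

end Order

/-! ## §2 `U(σ, H)` acts on the lattice graph without inversion -/

section Graph

variable (σ : K →+* K) (ϖ : K) (H : Matrix (Fin N) (Fin N) K)

/-- **`u ∈ U(σ, H)` STABILISES AN EDGE `s(v, w)` ONLY BY FIXING BOTH ENDS**: `Sym2.map (latticeGraphIso u) s(v, w) = s(v, w) ↔ u·v = v ∧ u·w = w`.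
[cite: BruhatTits1972, §10] [cite: Serre1980Trees, I.3.1] -/
theorem sym2Map_latticeGraphIso_eq_iff (u : unitaryGroupOfForm σ H) {v w : {M : Submodule 𝒪[K] (Fin N → K) // IsVertex σ ϖ H M}} (hadj : (latticeGraph σ ϖ H).Adj v w) :
    Sym2.map (latticeGraphIso σ ϖ H u) s(v, w) = s(v, w) ↔ latticeGraphIso σ ϖ H u v = v ∧ latticeGraphIso σ ϖ H u w = w := by
  rcases (latticeGraph_adj_iff σ ϖ H v w).1 hadj with h | h
  · exact NoInversion.sym2Map_mk_eq_iff_of_lt _ (Subtype.coe_lt_coe.1 ((mapGL_lt_mapGL_iff (u : GL (Fin N) K) v.1 w.1).2 h)) (Subtype.coe_lt_coe.1 h)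
  · have key := NoInversion.sym2Map_mk_eq_iff_of_lt (latticeGraphIso σ ϖ H u)
      (Subtype.coe_lt_coe.1 ((mapGL_lt_mapGL_iff (u : GL (Fin N) K) w.1 v.1).2 h)) (Subtype.coe_lt_coe.1 h)
    rw [Sym2.eq_swap (a := v), key, and_comm]

/-- **NO INVERSION**: every edge of `latticeGraph σ ϖ H` stabilised by `u ∈ U(σ, H)` is fixed pointwise. [cite: BruhatTits1972, §10] [cite: Serre1980Trees, I.3.1] -/
theorem latticeGraphIso_apply_eq_of_sym2Map_eq (u : unitaryGroupOfForm σ H) {e : Sym2 {M : Submodule 𝒪[K] (Fin N → K) // IsVertex σ ϖ H M}}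
    (he : e ∈ (latticeGraph σ ϖ H).edgeSet) (h : Sym2.map (latticeGraphIso σ ϖ H u) e = e) : ∀ v ∈ e, latticeGraphIso σ ϖ H u v = v := by
  induction e using Sym2.ind with
  | h x y =>
    obtain ⟨hx, hy⟩ := (sym2Map_latticeGraphIso_eq_iff σ ϖ H u ((SimpleGraph.mem_edgeSet _).1 he)).1 h
    intro v hv
    rcases Sym2.mem_iff.1 hv with rfl | rfl
    exacts [hx, hy]

/-- The same for the edge-set equivalence: `(latticeGraphIso u).mapEdgeSet e = e` forces `u` to fix both ends of `e`. [cite: BruhatTits1972, §10] [cite: Serre1980Trees, I.3.1] -/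
theorem latticeGraphIso_apply_eq_of_mapEdgeSet_eq (u : unitaryGroupOfForm σ H) {e : (latticeGraph σ ϖ H).edgeSet} (h : (latticeGraphIso σ ϖ H u).mapEdgeSet e = e) :
    ∀ v ∈ (e : Sym2 _), latticeGraphIso σ ϖ H u v = v :=
  latticeGraphIso_apply_eq_of_sym2Map_eq σ ϖ H u e.2 (congrArg Subtype.val h)

end Graph

/-! ## §3 (C): the printed reason — `U(σ, H)` preserves types and the ends of an edge have different types -/

section Types

variable {σ : K →+* K} {ϖ : K}

/-- **The two ends of an edge have DIFFERENT TYPES** (`σ` valuation-preserving, `ϖ ≠ 0`): vertices `M < M′` of types `d`, `d′` have `d ≠ d′` — comparable vertices of one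
type coincide (★ `eq_of_le_of_isVertexLattice`). [cite: BruhatTits1972, §10] [cite: Serre1980Trees, II.1.1] -/
theorem type_ne_of_lt (hvσ : ∀ a, Valued.v (σ a) = Valued.v a) (hϖ : ϖ ≠ 0) {H : Matrix (Fin N) (Fin N) K} {d d' : ℕ} {M M' : Submodule 𝒪[K] (Fin N → K)}
    (hM : IsVertexLattice σ ϖ H d M) (hM' : IsVertexLattice σ ϖ H d' M') (hlt : M < M') : d ≠ d' :=
  fun hdd' => hlt.ne (eq_of_le_of_isVertexLattice hvσ hϖ hM (hdd' ▸ hM') hlt.le)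

/-- A unitary `u` never maps a vertex of type `d` to a vertex of type `d′ ≠ d` (★ `isVertexLattice_mapGL` + ★ `type_unique`). [cite: BruhatTits1972, §10] -/
theorem mapGL_ne_of_type_ne (hvσ : ∀ a, Valued.v (σ a) = Valued.v a) (hϖ : Valued.v ϖ = WithZero.exp (-1 : ℤ)) {H : Matrix (Fin N) (Fin N) K}
    (u : GL (Fin N) K) (hu : u ∈ unitaryGroupOfForm σ H) {d d' : ℕ} {M M' : Submodule 𝒪[K] (Fin N → K)}
    (hM : IsVertexLattice σ ϖ H d M) (hM' : IsVertexLattice σ ϖ H d' M') (hdd' : d ≠ d') : mapGL u M ≠ M' :=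
  fun e => hdd' (type_unique hvσ hϖ (e ▸ isVertexLattice_mapGL σ ϖ H u hu hM) hM')

/-- **TYPE-PRESERVING ⟹ NO INVERSION.**  If `M`, `M′` are vertices of different types and a unitary `u` maps `{M, M′}` into itself, then `u·M = M` and `u·M′ = M′`.
[cite: BruhatTits1972, §10] [cite: Meier2008, Corollary 3.47] -/
theorem mapGL_eq_of_mapsTo_pair_of_type_ne (hvσ : ∀ a, Valued.v (σ a) = Valued.v a) (hϖ : Valued.v ϖ = WithZero.exp (-1 : ℤ)) {H : Matrix (Fin N) (Fin N) K}
    (u : GL (Fin N) K) (hu : u ∈ unitaryGroupOfForm σ H) {d d' : ℕ} {M M' : Submodule 𝒪[K] (Fin N → K)}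
    (hM : IsVertexLattice σ ϖ H d M) (hM' : IsVertexLattice σ ϖ H d' M') (hdd' : d ≠ d') (h : MapsTo (mapGL u) {M, M'} {M, M'}) :
    mapGL u M = M ∧ mapGL u M' = M' :=
  NoInversion.apply_eq_of_mapsTo_pair (mapGL u) h (mapGL_ne_of_type_ne hvσ hϖ u hu hM hM' hdd') (mapGL_ne_of_type_ne hvσ hϖ u hu hM' hM (Ne.symm hdd'))

/-- **The lattice graph is properly coloured BY TYPE, `U(σ, H)`-invariantly** (`σ` valuation-preserving, `ϖ` a uniformiser): there is a colouring `C` with `C v` = the type of `v`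
and `C (u·v) = C v` for every `u ∈ U(σ, H)` (at `N = 3`: the bipartition self-dual ∕ type two). [cite: BruhatTits1972, §10] [cite: Serre1980Trees, II.1.1] -/
theorem exists_coloring_type (hvσ : ∀ a, Valued.v (σ a) = Valued.v a) (hϖ : Valued.v ϖ = WithZero.exp (-1 : ℤ)) (H : Matrix (Fin N) (Fin N) K) :
    ∃ C : (latticeGraph σ ϖ H).Coloring ℕ, (∀ v, IsVertexLattice σ ϖ H (C v) v.1) ∧ ∀ (u : unitaryGroupOfForm σ H) (v), C (latticeGraphIso σ ϖ H u v) = C v := by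
  have hϖ0 : ϖ ≠ 0 := fun h0 => by rw [h0, map_zero] at hϖ; exact WithZero.coe_ne_zero hϖ.symm
  classical
  let t : {M : Submodule 𝒪[K] (Fin N → K) // IsVertex σ ϖ H M} → ℕ := fun v => Classical.choose v.2
  have ht : ∀ v : {M : Submodule 𝒪[K] (Fin N → K) // IsVertex σ ϖ H M}, IsVertexLattice σ ϖ H (t v) v.1 := fun v => Classical.choose_spec v.2
  refine ⟨SimpleGraph.Coloring.mk t fun {v w} hadj => ?_, ht, fun u v => ?_⟩
  · rcases (latticeGraph_adj_iff σ ϖ H v w).1 hadj with h | h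
    · exact type_ne_of_lt hvσ hϖ0 (ht v) (ht w) h
    · exact (type_ne_of_lt hvσ hϖ0 (ht w) (ht v) h).symm
  · exact type_unique hvσ hϖ (ht _) (isVertexLattice_mapGL σ ϖ H _ u.2 (ht v))

end Types

/-! ## §4 Subgroup currency: the set-stabiliser of an edge is `Stab(M) ⊓ Stab(M′)` (`P_F† = P_F`, `ε_F = 1`) -/

section Subgroups

/-- The STABILISER of a lattice `M` in `GL_N(K)`, as a subgroup given by its membership test `g·M = M`. [cite: BruhatTits1972, §10] [cite: Serre1980Trees, II.1.1] -/
theorem exists_subgroup_mem_iff_mapGL_eq (M : Submodule 𝒪[K] (Fin N → K)) : ∃ P : Subgroup (GL (Fin N) K), ∀ g, g ∈ P ↔ mapGL g M = M := by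
  refine ⟨{ carrier := {g | mapGL g M = M}, mul_mem' := fun {a b} ha hb => ?_, one_mem' := mapGL_one M, inv_mem' := fun {g} hg => ?_ }, fun g => Iff.rfl⟩
  · change mapGL (a * b) M = M
    rw [mapGL_mul, show mapGL b M = M from hb, show mapGL a M = M from ha]
  · change mapGL g⁻¹ M = M
    have h : mapGL g⁻¹ (mapGL g M) = mapGL g⁻¹ M := by rw [show mapGL g M = M from hg]
    rwa [← mapGL_mul, inv_mul_cancel, mapGL_one, eq_comm] at h

/-- The SET-STABILISER `P_F†` of a pair `F = {M, M′}` in `GL_N(K)`, as a subgroup given by its membership test `g·{M, M′} = {M, M′}`. [cite: SchneiderStuhler1997, III.4] -/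
theorem exists_subgroup_mem_iff_mapGL_image_pair_eq (M M' : Submodule 𝒪[K] (Fin N → K)) :
    ∃ P : Subgroup (GL (Fin N) K), ∀ g, g ∈ P ↔ mapGL g '' {M, M'} = {M, M'} := by
  have hmul : ∀ a b : GL (Fin N) K, mapGL (a * b) = mapGL a ∘ mapGL b := fun a b => funext fun L => mapGL_mul a b L
  refine ⟨{ carrier := {g | mapGL g '' {M, M'} = {M, M'}}, mul_mem' := fun {a b} ha hb => ?_, one_mem' := ?_, inv_mem' := fun {g} hg => ?_ }, fun g => Iff.rfl⟩
  · change mapGL (a * b) '' {M, M'} = {M, M'}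
    rw [hmul, image_comp, show mapGL b '' {M, M'} = {M, M'} from hb, show mapGL a '' {M, M'} = {M, M'} from ha]
  · change mapGL 1 '' {M, M'} = {M, M'}
    rw [show (mapGL (1 : GL (Fin N) K) : Submodule 𝒪[K] (Fin N → K) → Submodule 𝒪[K] (Fin N → K)) = id from funext mapGL_one, image_id]
  · change mapGL g⁻¹ '' {M, M'} = {M, M'}
    have h : mapGL g⁻¹ '' (mapGL g '' {M, M'}) = mapGL g⁻¹ '' {M, M'} := by rw [show mapGL g '' {M, M'} = {M, M'} from hg]
    rwa [← image_comp, ← hmul, inv_mul_cancel, show (mapGL (1 : GL (Fin N) K) : Submodule 𝒪[K] (Fin N → K) → Submodule 𝒪[K] (Fin N → K)) = id from funext mapGL_one,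
      image_id, eq_comm] at h

/-- **`P_F† = P_F`: THE SET-STABILISER OF AN EDGE `F = {M, M′}` (`M < M′`) IS `Stab(M) ⊓ Stab(M′)`** — so the orientation character `ε_F` of the oriented chain complex is trivial.
Hypothesis style: any subgroups `P`, `P′`, `P_F` with the displayed membership tests. [cite: SchneiderStuhler1997, III.4] [cite: BruhatTits1972, §10] -/
theorem eq_inf_of_mem_iff_mapGL_image_pair_eq {M M' : Submodule 𝒪[K] (Fin N → K)} (hlt : M < M') {P P' PF : Subgroup (GL (Fin N) K)}
    (hP : ∀ g, g ∈ P ↔ mapGL g M = M) (hP' : ∀ g, g ∈ P' ↔ mapGL g M' = M') (hPF : ∀ g, g ∈ PF ↔ mapGL g '' {M, M'} = {M, M'}) : PF = P ⊓ P' := by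
  ext g
  rw [hPF, Subgroup.mem_inf, hP, hP', mapGL_image_pair_eq_iff_of_lt g hlt]

/-- `P_F† = P_F` for an edge `{v, w}` of `latticeGraph σ ϖ H`. [cite: SchneiderStuhler1997, III.4] [cite: BruhatTits1972, §10] -/
theorem eq_inf_of_mem_iff_mapGL_image_pair_eq_of_adj (σ : K →+* K) (ϖ : K) (H : Matrix (Fin N) (Fin N) K)
    {v w : {M : Submodule 𝒪[K] (Fin N → K) // IsVertex σ ϖ H M}} (hadj : (latticeGraph σ ϖ H).Adj v w) {P P' PF : Subgroup (GL (Fin N) K)}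
    (hP : ∀ g, g ∈ P ↔ mapGL g v.1 = v.1) (hP' : ∀ g, g ∈ P' ↔ mapGL g w.1 = w.1) (hPF : ∀ g, g ∈ PF ↔ mapGL g '' {v.1, w.1} = {v.1, w.1}) : PF = P ⊓ P' := by
  ext g
  rw [hPF, Subgroup.mem_inf, hP, hP', mapGL_image_pair_eq_iff_of_adj σ ϖ H hadj g]

end Subgroups

end Literature.NumberTheory.Automorphic.UnitaryLatticeTree

end
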